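import Literature.Topology.FourManifolds.WallBoundingHandlebody
import Literature.Topology.FourManifolds.WallHandlebodyHandles
import Literature.Topology.FourManifolds.WallHandlebodyProgram
import Literature.Topology.FourManifolds.WallHandlebodyHomology
import Literature.Topology.FourManifolds.WallHandlebodyHCobordism
import Literature.Topology.FourManifolds.HCobordismWallDualityProofs
import HarnessLib

/-!
# Wall 1964, Lemma 2 (`exists_handlebody_isHCobordant_boundary`) from Milnor's handle calculus

Topic `Literature/Topology/FourManifolds` (fact seat
`provefact-Literature.Topology.FourManifolds.exists-68ee520c9a`).  This file assembles the
**Morse-theoretic route** to Wall's Lemma 2 recorded in the module docstring of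
`WallBoundingHandlebody.lean` (`## Route to the discharge`) from its proved bricks:

1. `WallHandlebodyBall.lean`, `WallHandlebodySlab.lean` — the bottom ball `D = {f ≤ a₀}` about
   the minimum of a Morse function `f` of `(W; ∅, M)` and the slab `K = f⁻¹[a₀, b₀]`, a
   cobordism from `𝕊⁴ = f⁻¹(a₀)` to `f⁻¹(b₀) ≅ M`, simply connected with simply connected
   incoming end and `H₀(K, 𝕊⁴) = 0`;
2. `WallHandlebodyHomology.lean` — `Hᵢ(K, 𝕊⁴) = 0` for `i ≠ 2` and `H₂(K, 𝕊⁴) ≅ H₂(W)` free of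
   rank `k`;
3. `WallHandlebodyProgram.lean` — Milnor's §§4–8 on `K` (GIVEN the Basis Theorem 7.6 on a slab):
   a Morse function `g` of the triad with all indices `≥ 2` and a non-critical level `m` below
   which lie exactly `k` critical points, all of index `2`, with `H⁎({g ≤ 1}, {g ≤ m}) = 0`;
4. `WallHandlebodyLevels.lean`, `WallHandlebodyHCobordism.lean` — `C = g⁻¹[m, b₁]` is an
   h-cobordism from `g⁻¹(m)` to a copy of `M` (GIVEN the duality step);
5. `WallHandlebodyBlend.lean`, `WallHandlebodySplice.lean`, `WallHandlebodyHandles.lean` — one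
   smooth Morse function on `W` cutting out the handlebody `H = D ∪ {g ≤ m}` with one
   0-handle and `k` 2-handles, `∂H ≅ g⁻¹(m)`.

Hence (`exists_handlebody_isHCobordant_boundary_of_facts`) Wall's Lemma 2 holds GIVEN the two
upstream named facts `Cobordism.Milnor1965_basisTheorem_slab` (Milnor 1965, Thm. 7.6 on a slab)
and `Cobordism.isZero_relativeSingularHomology_inl_of_inr_le` (Poincaré–Lefschetz duality on a
cobordism, Hatcher Thm. 3.43); the discharge `exists_handlebody_isHCobordant_boundary_holds`
follows as soon as they land — the duality step has landed (`HCobordismWallDualityProofs.lean`), whence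
`exists_handlebody_isHCobordant_boundary_of_basisTheorem`.  No named facts are introduced here.

## References

* C. T. C. Wall, *On simply-connected 4-manifolds*, J. London Math. Soc. 39 (1964), Lemma 2
  and its proof (pp. 143–144). [WallJLMS1964]
* J. Milnor, *Lectures on the h-cobordism theorem* (1965), §§2–8. [MilnorHCobordism1965]
* A. Hatcher, *Algebraic Topology* (2002), §2.1, Thm. 3.43, Cor. 4.33. [HatcherAT2002]
-/

open scoped Manifold ContDiff Topology
open Set Function CategoryTheory CategoryTheory.Limits
open Literature.AlgebraicTopology.SingularHomology

noncomputable section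

namespace Literature.Topology.FourManifolds

/-- **Wall 1964, Lemma 2, GIVEN Milnor's Basis Theorem on a slab and the duality step** (the
module docstring displays the route).  From `hB : Cobordism.Milnor1965_basisTheorem_slab` and
`hD : Cobordism.isZero_relativeSingularHomology_inl_of_inr_le`: if the simply connected closed
smooth 4-manifold `M` bounds a compact `W` with `W` simply connected, `Hᵢ(W; ℤ) = 0` for
`i ≥ 3` and `H₂(W; ℤ)` finitely generated free of rank `k`, then there is a handlebody
`H = ℋ(D⁵, k, 2)` with `M` h-cobordant to `∂H`. [cite: WallJLMS1964, Lemma 2 and its proof (pp. 143–144)] [cite: MilnorHCobordism1965, Thms. 2.5, 3.4, 4.1–4.2, 4.8, 7.6, 8.1, Lemma 2.9, Cor. 3.15] [cite: HatcherAT2002, Thm. 3.43, Cor. 4.33] -/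
theorem exists_handlebody_isHCobordant_boundary_of_facts
    (hB : Cobordism.Milnor1965_basisTheorem_slab.{0})
    (hD : Cobordism.isZero_relativeSingularHomology_inl_of_inr_le.{0}) :
    exists_handlebody_isHCobordant_boundary := by
  intro M _ _ _ _ _ _ _ c hW hH3 hfree hfin
  haveI : SimplyConnectedSpace c.cob.W := hW
  haveI : Module.Free ℤ (singularHomology ℤ ℤ c.cob.W 2) := hfree
  haveI : Module.Finite ℤ (singularHomology ℤ ℤ c.cob.W 2) := hfin
  have hH3' : ∀ k, 3 ≤ k → IsZero (singularHomology ℤ ℤ c.cob.W k) := hH3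
  have hn1 : 1 ≤ 4 := by norm_num
  have hn2 : 2 ≤ 4 := by norm_num
  -- item 1: the bottom ball and the slab `K`
  obtain ⟨S⟩ := c.nonempty_bottomSlab
  have hf := S.isMorseFunction
  haveI hKsc : SimplyConnectedSpace S.cobordism.W := S.simplyConnectedSpace_K hn2
  haveI : SimplyConnectedSpace (RegularSlab.botEnd S.isRegularSlab) := S.simplyConnectedSpace_botEnd hn2
  obtain ⟨eM⟩ := S.nonempty_diffeomorph_topEnd
  haveI : SimplyConnectedSpace (RegularSlab.topEnd S.isRegularSlab) :=
    eM.toHomeomorph.toHomotopyEquiv.simplyConnectedSpace_iff.1 inferInstance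
  -- item 2: the homology of `(K, f⁻¹(a₀))`
  haveI : ContractibleSpace ↥{z : c.cob.W | S.f z ≤ S.botLevel} := S.contractibleSpace_setOf_le
  have hrega : ∀ z ∈ criticalSet (𝓡∂ (4 + 1)) S.f, S.f z ≠ S.botLevel := fun z hz => S.ne_botLevel hz
  have hzero' : ∀ i, i ≠ 2 →
      IsZero (relativeSingularHomology ℤ ℤ ↥(S.f ⁻¹' Icc S.botLevel S.b₀) {z | S.f z.1 = S.botLevel} i) :=
    fun i hi => isZero_relativeSingularHomology_slab hf S.botLevel_pos S.botLevel_lt_b₀ S.b₀_lt_one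
      hrega S.apply_lt_b₀ hH3' i hi
  obtain ⟨hfree', hfin', hrank'⟩ := free_finite_finrank_relativeSingularHomology_slab_two hf
    S.botLevel_pos S.botLevel_lt_b₀ S.b₀_lt_one hrega S.apply_lt_b₀
  have hrange : range S.cobordism.inl =
      {p : RegularSlab S.isRegularSlab | S.f (RegularSlab.incl S.isRegularSlab p) = S.botLevel} :=
    RegularSlab.range_cobordism_inl S.isRegularSlab
  have hzero : ∀ i, i ≠ 2 → IsZero (relativeSingularHomology ℤ ℤ S.cobordism.W (range S.cobordism.inl) i) := by
    intro i hi; rw [hrange]; exact hzero' i hi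
  haveI : Module.Free ℤ (relativeSingularHomology ℤ ℤ S.cobordism.W (range S.cobordism.inl) 2) := by
    rw [hrange]; exact hfree'
  haveI : Module.Finite ℤ (relativeSingularHomology ℤ ℤ S.cobordism.W (range S.cobordism.inl) 2) := by
    rw [hrange]; exact hfin'
  have hrank : Module.finrank ℤ (relativeSingularHomology ℤ ℤ S.cobordism.W (range S.cobordism.inl) 2) =
      Module.finrank ℤ (singularHomology ℤ ℤ c.W 2) := by
    rw [hrange]; exact hrank'
  -- item 3: Milnor's §§4–8 on `K`
  obtain ⟨g, m, hg, h2, hm, hregm, hidx, hcount, hacyc⟩ :=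
    Cobordism.exists_isMorseFunction_sublevel_acyclic hB S.cobordism (S.exists_joined_inl hn2) hrank hzero
  -- item 4: the top part is an h-cobordism
  obtain ⟨b₁, h₁, hcob⟩ := hg.exists_isHCobordant_botEnd hD h2 hm hregm hidx hacyc
  -- item 5: the handlebody
  obtain ⟨D⟩ := S.nonempty_splice hn1 hg hm
  obtain ⟨H, iT, iT2, iSC, iCS, iIM, iCpt, hHD, ⟨eH⟩⟩ := D.exists_handlebody hn1 hg hregm h₁
  -- the count of handles: one 0-handle, `k` 2-handles
  set k := Module.finrank ℤ (singularHomology ℤ ℤ c.W 2) with hk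
  have hcnt : (fun j => (if j = 0 then 1 else 0) +
      (criticalSetOfIndex (𝓡∂ (4 + 1)) g j ∩ g ⁻¹' Iio m).ncard) = twoHandlebodyCount k := by
    funext j
    have hset : criticalSetOfIndex (𝓡∂ (4 + 1)) g j ∩ g ⁻¹' Iio m =
        if j = 2 then criticalSet (𝓡∂ (4 + 1)) g ∩ g ⁻¹' Iio m else ∅ := by
      ext z
      simp only [mem_inter_iff, mem_preimage, mem_Iio]
      constructor
      · rintro ⟨⟨hz, hzi⟩, hzm⟩
        have hj : j = 2 := by rw [← hzi, hidx z hz hzm]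
        subst hj
        rw [if_pos rfl]
        exact ⟨hz, hzm⟩
      · intro h
        by_cases hj : j = 2
        · subst hj
          rw [if_pos rfl] at h
          exact ⟨⟨h.1, hidx z h.1 h.2⟩, h.2⟩
        · rw [if_neg hj] at h
          exact absurd h (notMem_empty z)
    rw [hset, twoHandlebodyCount]
    by_cases hj0 : j = 0
    · subst hj0
      have h02 : ((if (0 : ℕ) = 2 then criticalSet (𝓡∂ (4 + 1)) g ∩ g ⁻¹' Iio m else ∅) :
          Set S.cobordism.W) = ∅ := if_neg (by norm_num)
      rw [h02, Set.ncard_empty, if_pos rfl, if_pos rfl]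
    · by_cases hj2 : j = 2
      · subst hj2
        rw [if_pos rfl, hcount, if_neg hj0, if_neg hj0, if_pos rfl, zero_add]
      · rw [if_neg hj2, Set.ncard_empty, if_neg hj0, if_neg hj0, if_neg hj2]
  obtain ⟨F, hF, hFc⟩ := hHD
  have hHD' : HasHandleDecomposition 4 H (twoHandlebodyCount k) :=
    ⟨F, hF, fun j => (hFc j).trans (congrFun hcnt j)⟩
  -- the h-cobordism `M ~ ∂H`
  have hMH : IsHCobordant 4 M ((𝓡∂ (4 + 1)).boundary H) :=
    (hcob.of_diffeomorph_left eM).of_diffeomorph_right eH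
  exact ⟨H, iT, iT2, iSC, iCS, iIM, iCpt, hHD', hMH⟩

/-- **Wall 1964, Lemma 2, GIVEN only Milnor's Basis Theorem 7.6 on a slab**: the duality step
`Cobordism.isZero_relativeSingularHomology_inl_of_inr_le` is discharged in the tree
(`Cobordism.isZero_relativeSingularHomology_inl_of_inr_le_holds`, `HCobordismWallDualityProofs.lean`),
so Wall's Lemma 2 is reduced to the one upstream named fact `Cobordism.Milnor1965_basisTheorem_slab`.
[cite: WallJLMS1964, Lemma 2 and its proof (pp. 143–144)] [cite: MilnorHCobordism1965, Thm. 7.6 (PDF p. 50)] -/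
theorem exists_handlebody_isHCobordant_boundary_of_basisTheorem
    (hB : Cobordism.Milnor1965_basisTheorem_slab.{0}) : exists_handlebody_isHCobordant_boundary :=
  exists_handlebody_isHCobordant_boundary_of_facts hB
    Cobordism.isZero_relativeSingularHomology_inl_of_inr_le_holds

end Literature.Topology.FourManifolds
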